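import Literature.NumberTheory.EllipticCurves.HeegnerPointsKolyvaginPrimaryOrderHCTVProofs
import Literature.NumberTheory.EllipticCurves.ModularityVersionApProofs
import HarnessLib

/-!
# Kolyvagin's descent for an ABSTRACT system of classes, I: the Cassels–Tate value at `λ`
# (McCallum 1991, Prop. 4.7 / Thm. 5.4, with the Heegner-point binder replaced by good reduction at the Kolyvagin primes)

Topic `NumberTheory/EllipticCurves`; namespace `Literature.NumberTheory.EllipticCurves`. Theorems only:
**no definition and no named fact is introduced** (D-0026). Sibling of
`HeegnerPointsKolyvaginPrimaryOrderCTValueProofs` and `HeegnerPointsKolyvaginPrimaryOrderHCTVProofs`.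

WHY. The tree's Kolyvagin ORDER-bound chain (`…PrimaryOrderCTValueProofs` →
`…PrimaryOrderHCTVProofs` → `…PrimaryOrderBoundProofs` → `…PrimaryShaBoundProofs`; McCallum 1991 §1
Theorem / Thm. 5.4 / Cor. 5.6, order form) is stated for a Heegner point `Pt` of level `N₀`,
`IsHeegnerPoint N₀ W K Pt`. Inspection of the chain shows that this binder is consumed at exactly
ONE site, `IsKolyvaginPrime.not_mem_badPlaces` in the proof of
`ctLevelPairing_pullback_ne_zero_iff_localTerm_kolyvaginClass`: good reduction of `E/K` at the place
`λ` of a Kolyvagin prime `ℓ ∤ N₀` (Gross 1991, §3 (3.1) with §7). Everything else in the descent —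
the Kolyvagin classes `cl`, their eigen-signs and local behaviour, the dual statement, the Cassels–Tate
inputs, Kolyvagin's annihilation — is ALREADY abstract (displayed hypotheses). McCallum's argument is
therefore a theorem about any family of classes with these properties over an imaginary quadratic
field, for any elliptic `E/ℚ` with good reduction at the Kolyvagin primes of the chosen level `N₀`
(e.g. `N₀` a multiple of every bad prime: `IsKolyvaginPrime.not_mem_badPlaces_of_dvd` below). This
file and its sequel `KolyvaginDescentAbstractSystemShaBoundProofs` record the chain in that
generality, VERBATIM (same proofs), so that Heegner SYSTEMS which are not `E`'s own
`X₀(N_E)`-Heegner points over a field with the Heegner hypothesis — points transported along a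
quadratic or cubic twist from another curve, genus-character components, CM points of other levels —
can be fed to the same kernel. Nothing here is new mathematics: it is McCallum's §§4–5 read for an
abstract Euler-system input, as in Kolyvagin's own axiomatic formulation and Rubin's *Euler systems*,
Ch. II (the bound depends only on the classes and their local properties).

* `IsKolyvaginPrime.not_mem_badPlaces_of_dvd` — if every prime of bad reduction of `W` divides `N₀`,
  then `W/K` has good reduction at the place of every Kolyvagin prime of level `N₀`
  (`WeierstrassCurve.dvd_conductorNorm_iff`, Diamond–Shurman §8.3; base change, Silverman VII.5.1).
* `KolyvaginDescent.ctLevelPairing_pullback_ne_zero_iff_localTerm_kolyvaginClass_of_notMemBad` —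
  McCallum's Prop. 4.7 for the descent data (the tree's theorem with the binder replaced).
* `KolyvaginDescent.HypothesesM.hCTV_of_localTerm_of_notMemBad` — the value formula `hCTV` from the
  local term at `λ` (the tree's theorem with the binder replaced).

## References

* [McCallumLMS1991] W. G. McCallum, *Kolyvagin's work on Shafarevich–Tate groups* (1991), §4
  Lemma 4.3, Prop. 4.4, Prop. 4.7; §5 Lemma 5.3, Thm. 5.4 (proof).
* [GrossLMS1991] B. H. Gross, *Kolyvagin's work on modular elliptic curves* (1991), §3 (3.1)–(3.2), §7.
* [KolyvaginEulerSystems1990] V. A. Kolyvagin, *Euler systems*, The Grothendieck Festschrift II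
  (1990), §1 (cite only; not held).
* [MilneADT2006] J. S. Milne, *Arithmetic Duality Theorems*, 2nd ed. (2006), Ch. I §6.
* [DiamondShurman2005] F. Diamond, J. Shurman, *A First Course in Modular Forms* (2005), §8.3.
-/

noncomputable section

open scoped Classical
open scoped AddSubgroup

universe u

namespace Literature.NumberTheory.EllipticCurves

open CategoryTheory _root_.WeierstrassCurve Field Function NumberField IsDedekindDomain
open Literature.NumberTheory.GaloisRepresentations Literature.NumberTheory.GaloisCohomology
open Literature.NumberTheory.GaloisRepresentations.DiscreteGaloisModule (mu MuCarrier pairing)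
open Literature.GroupTheory.FiniteAbelian
open scoped ContRepresentation

/-! ## Good reduction at the Kolyvagin primes from the level -/

section GoodReduction

variable {N : ℕ} [NeZero N] {W : WeierstrassCurve ℚ} [W.IsElliptic] {K : Type u} [Field K]
  [NumberField K]

omit [NeZero N] in
/-- **`E/K` has good reduction at the place of every Kolyvagin prime of level `N₀`, as soon as every
prime of bad reduction of `E` divides `N₀`** (Gross 1991, §3 (3.1): `ℓ ∤ N`; here `N` need not be the
conductor, only a multiple of its support): `ℓ ∤ N₀` gives `ℓ ∤ N_E`, i.e. good reduction of `W/ℚ` at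
`(ℓ)` (`WeierstrassCurve.dvd_conductorNorm_iff`, Diamond–Shurman §8.3), which base-changes to the place
`λ` of `K` (`hasGoodReductionAt_baseChange_of_hasGoodReductionAt_rat`, Silverman VII.5.1(a)).
[cite: GrossLMS1991, §3 (3.1) with §7] [cite: DiamondShurman2005, §8.3 (PDF p. 353)] -/
theorem IsKolyvaginPrime.not_mem_badPlaces_of_dvd
    (hN : ∀ ℓ : ℕ, ℓ.Prime → ℓ ∣ W.conductorNorm ℤ → ℓ ∣ N)
    {p ℓ : ℕ} (hℓ : IsKolyvaginPrime N W K p ℓ) :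
    hℓ.place ∉ (W.baseChange K).badPlaces (𝓞 K) := by
  rw [mem_badPlaces_iff, not_not]
  haveI : hℓ.place.asIdeal.LiesOver (hℓ.place.under (𝓞 ℚ)).asIdeal := ⟨rfl⟩
  refine hasGoodReductionAt_baseChange_of_hasGoodReductionAt_rat W (hℓ.place.under (𝓞 ℚ)) hℓ.place ?_
  have hv : (Rat.HeightOneSpectrum.primesEquiv (hℓ.place.under (𝓞 ℚ)) : ℕ) = ℓ :=
    primesEquiv_eq_of_natCast_mem hℓ.prime hℓ.natCast_mem_under
  by_contra hbad
  have hdvd := (W.dvd_conductorNorm_iff (hℓ.place.under (𝓞 ℚ))).mpr hbad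
  rw [hv] at hdvd
  exact hℓ.2.1 (hN ℓ hℓ.prime hdvd)

end GoodReduction

namespace KolyvaginDescent

-- Cup products need `LocallyCompactSpace Γ`; as in the tree's cup-product files, the compactness of
-- absolute Galois groups is a local instance only.
attribute [local instance] absoluteGaloisGroup_compactSpace

-- `char K_v = 0` for the completions of a number field (local instance, no override).
attribute [local instance] charZero_placeCompletion

variable (W : WeierstrassCurve ℚ) {K : Type u} [Field K] [NumberField K]

omit [NumberField K] in
/-- A finite place containing (the image of) a square-free natural number contains one of its prime
factors (`m' = ∏ q`, primality of the place). [folklore] -/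
private theorem exists_mem_primeFactors_natCast_mem' {m' : ℕ} (hm' : Squarefree m')
    {v : HeightOneSpectrum (𝓞 K)} (hv : (m' : 𝓞 K) ∈ v.asIdeal) :
    ∃ q ∈ m'.primeFactors, (q : 𝓞 K) ∈ v.asIdeal := by
  rw [← Nat.prod_primeFactors_of_squarefree hm', Nat.cast_prod] at hv
  exact (Ideal.IsPrime.prod_mem_iff (hp := v.isPrime)).mp hv

section Value

variable [W.IsElliptic] {p M₀ : ℕ} [NeZero (p ^ M₀)]
variable (e : geomTorsion (W.baseChange K) ((p ^ M₀ * p ^ M₀ : ℕ) : ℤ) →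
    geomTorsion (W.baseChange K) ((p ^ M₀ * p ^ M₀ : ℕ) : ℤ) → AlgebraicClosure K)
  (hμ : ∀ S T, e S T ^ (p ^ M₀ * p ^ M₀) = 1)
  (hadd₁ : ∀ S₁ S₂ T, e (S₁ + S₂) T = e S₁ T * e S₂ T)
  (hadd₂ : ∀ S T₁ T₂, e S (T₁ + T₂) = e S T₁ * e S T₂)
  (hgal : ∀ (σ : absoluteGaloisGroup K) (S T : geomTorsion (W.baseChange K) ((p ^ M₀ * p ^ M₀ : ℕ) : ℤ)),
    σ • e S T = e (σ • S) (σ • T))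
variable (inv : LocalInvariants K (p ^ M₀ * p ^ M₀))
-- `hPT'` is the reciprocity predicate `LocalInvariants.SumInvLocalizationEqZero` on `inv`, not a named fact.
variable (halt : ∀ T, e T T = 1) (hPT' : inv.SumInvLocalizationEqZero)
  (hH3 : ∀ c : galoisCohomology (mu K (p ^ M₀ * p ^ M₀)) 3,
    (∀ v : Place K, galoisCohomology.localization (mu K (p ^ M₀ * p ^ M₀)) v 3 c = 0) → c = 0)
  (hfin : ∀ D : GeneralCaseData (W.baseChange K) (p ^ M₀) e hμ hadd₁ hadd₂ hgal,
    ∃ S : Finset (Place K), ∀ v ∉ S, D.localTerm inv v = 0)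
variable (ι : selmerGroup (W.baseChange K) ((p ^ M₀ * p ^ M₀ : ℕ) : ℤ) →+ ((W.baseChange K).sha)[p ^ M₀])
  (hι : ∀ z, shaTorsionVal (W.baseChange K) (p ^ M₀) (ι z) =
    torsionH1ToH1 (W.baseChange K) ((p ^ M₀ * p ^ M₀ : ℕ) : ℤ) z)

include halt hPT' hι in
/-- **The Cassels–Tate value on a Kolyvagin pair is the local term at `λ` — for an ABSTRACT family of
classes** (McCallum 1991, Prop. 4.7 as used in the proof of Thm. 5.4, p. 288, at level `M = 2M₀`,
`m = p^{M₀}`). Verbatim the tree's `ctLevelPairing_pullback_ne_zero_iff_localTerm_kolyvaginClass`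
(`HeegnerPointsKolyvaginPrimaryOrderCTValueProofs`), with its Heegner-point binder
`IsHeegnerPoint N W K P` — consumed there ONLY through `IsKolyvaginPrime.not_mem_badPlaces`
(good reduction of `E/K` at the place `λ` of each Kolyvagin prime) — replaced by that consequence
`hbad` as a hypothesis. Setting: `E = W/ℚ` elliptic, `K` imaginary quadratic, `p` odd with `ρ̄_{E,p}`
onto, `E/K` with good reduction at the Kolyvagin primes of level `N`; classes
`c(n) ∈ H¹(K, E[p^{2M₀}])` Selmer off `n` (McCallum's Lemma 4.3) at the square-free products of
Kolyvagin primes of level `p^{2M₀}`; `ℓ` such a prime, `n = ℓ m'` such a product; `z = p^j c(n) ∈ Sel`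
with `M₀ ≤ j`; `t ∈ Sel` with `p^N t = 0`, `N ≤ M₀`, `t_v = 0` at the places over the primes of `m'`.
Then first-case data `D` with `D.b₁ = p^{j-M₀} c(n)`, `ι_* D.b' = t` exist, and for every such `D` the
pulled-back level-`p^{M₀}` Cassels–Tate pairing `B(ι z, ι t)` is non-zero iff the local term
`inv_λ((loc_λ D.b₁ - β_λ) ∪ β'_λ)` at `λ = (ℓ)` is non-zero. (The point of the generalisation: the
descent applies to ANY system of classes with these properties — e.g. classes transported from the
Heegner points of another curve along a twist — not only to `E`'s own `X₀(N)`-Heegner classes.)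
[cite: McCallumLMS1991, §4 Lemma 4.3, Prop. 4.7; §5 Thm. 5.4 (proof)] [cite: GrossLMS1991, §3 (3.1)–(3.2)] -/
theorem ctLevelPairing_pullback_ne_zero_iff_localTerm_kolyvaginClass_of_notMemBad
    (hK : IsImaginaryQuadratic K) {N : ℕ} [NeZero N]
    (hbad : ∀ ⦃q : ℕ⦄ (h : IsKolyvaginPrime N W K p q), h.place ∉ (W.baseChange K).badPlaces (𝓞 K))
    (hp : p.Prime) (hp2 : p ≠ 2) (hρ : W.HasSurjectiveModNGaloisRep p)
    (cl : ℕ → galH1Torsion (W.baseChange K) ((p ^ M₀ * p ^ M₀ : ℕ) : ℤ))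
    (hcl : ∀ n : ℕ, Squarefree n →
      (∀ q ∈ n.primeFactors, IsKolyvaginPrime N W K p q ∧ FrobEqFrobInfty W K (p ^ M₀ * p ^ M₀) q) →
      ∀ v : HeightOneSpectrum (𝓞 K), (n : 𝓞 K) ∉ v.asIdeal →
        cl n ∈ selmerLocalKer (W.baseChange K) (v.adicCompletion K) ((p ^ M₀ * p ^ M₀ : ℕ) : ℤ))
    {ℓ m' : ℕ} (hℓ : IsKolyvaginPrime N W K p ℓ ∧ FrobEqFrobInfty W K (p ^ M₀ * p ^ M₀) ℓ)
    (hsupp : KolSupp (fun q => IsKolyvaginPrime N W K p q ∧ FrobEqFrobInfty W K (p ^ M₀ * p ^ M₀) q)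
      (ℓ * m'))
    {j N' : ℕ} (hj : M₀ ≤ j) (hN' : N' ≤ M₀)
    {t : galH1Torsion (W.baseChange K) ((p ^ M₀ * p ^ M₀ : ℕ) : ℤ)}
    (ht : t ∈ selmerGroup (W.baseChange K) ((p ^ M₀ * p ^ M₀ : ℕ) : ℤ))
    (hz : ((p : ℤ) ^ j) • cl (ℓ * m') ∈ selmerGroup (W.baseChange K) ((p ^ M₀ * p ^ M₀ : ℕ) : ℤ))
    (hpt : ((p : ℤ) ^ N') • t = 0)
    (hAq : ∀ q ∈ m'.primeFactors, ∀ v : HeightOneSpectrum (𝓞 K), (q : 𝓞 K) ∈ v.asIdeal →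
      t ∈ (W.baseChange K).torsionLocalKer (v.adicCompletion K) ((p ^ M₀ * p ^ M₀ : ℕ) : ℤ)) :
    (∃ D : FirstCaseData (W.baseChange K) (p ^ M₀), D.b₁ = ((p : ℤ) ^ (j - M₀)) • cl (ℓ * m') ∧
      galoisCohomology.map (inclKD (W.baseChange K) (p ^ M₀) (p ^ M₀)) 1 D.b' = t) ∧
    ∀ D : FirstCaseData (W.baseChange K) (p ^ M₀), D.b₁ = ((p : ℤ) ^ (j - M₀)) • cl (ℓ * m') →
      galoisCohomology.map (inclKD (W.baseChange K) (p ^ M₀) (p ^ M₀)) 1 D.b' = t →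
      (ctLevelPairing (W.baseChange K) (p ^ M₀) e hμ hadd₁ hadd₂ hgal inv halt hPT' hH3 hfin
          (ι ⟨_, hz⟩) (ι ⟨t, ht⟩) ≠ 0 ↔
        D.localTerm e hμ hadd₁ hadd₂ hgal inv (Sum.inr hℓ.1.place) ≠ 0) := by
  have hk0 : p ^ M₀ * p ^ M₀ ≠ 0 := mul_ne_zero (NeZero.ne _) (NeZero.ne _)
  -- `z = p^{M₀} • (p^{j-M₀} • c(n))`
  have hz' : ((⟨_, hz⟩ : selmerGroup (W.baseChange K) ((p ^ M₀ * p ^ M₀ : ℕ) : ℤ)) :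
      galH1Torsion (W.baseChange K) ((p ^ M₀ * p ^ M₀ : ℕ) : ℤ)) =
        ((p ^ M₀ : ℕ) : ℤ) • ((p : ℤ) ^ (j - M₀)) • cl (ℓ * m') := by
    have h1 : ((p ^ M₀ : ℕ) : ℤ) * (p : ℤ) ^ (j - M₀) = (p : ℤ) ^ j := by
      rw [Nat.cast_pow, ← pow_add, Nat.add_sub_cancel' hj]
    change ((p : ℤ) ^ j) • cl (ℓ * m') = _
    rw [← mul_smul, h1]
  -- `p^{M₀} • t = 0`
  have hmt : ((p ^ M₀ : ℕ) : ℤ) • ((⟨t, ht⟩ : selmerGroup (W.baseChange K) ((p ^ M₀ * p ^ M₀ : ℕ) : ℤ)) :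
      galH1Torsion (W.baseChange K) ((p ^ M₀ * p ^ M₀ : ℕ) : ℤ)) = 0 := by
    have h2 : ((p ^ M₀ : ℕ) : ℤ) = (p : ℤ) ^ (M₀ - N') * (p : ℤ) ^ N' := by
      rw [Nat.cast_pow, ← pow_add, Nat.sub_add_cancel hN']
    change ((p ^ M₀ : ℕ) : ℤ) • t = 0
    rw [h2, mul_smul, hpt, zsmul_zero]
  -- `E[p^{M₀}]` has no non-zero `Γ_K`-fixed point
  have hfix : ∀ Q : geomTorsion (W.baseChange K) ((p ^ M₀ : ℕ) : ℤ),
      (∀ σ : absoluteGaloisGroup K, σ • Q = Q) → Q = 0 :=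
    fun Q hQ => forall_smul_eq_imp_eq_zero_of_surjective W hK hp hp2 hρ M₀ Q hQ
  refine ⟨exists_firstCaseData_kolyvagin (W := W.baseChange K) (m := p ^ M₀) ⟨_, hz⟩ ⟨t, ht⟩
      (cl (ℓ * m')) ((p : ℤ) ^ (j - M₀)) hz' hfix hmt, fun D hD₁ hDt => ?_⟩
  -- the places `T` over the primes of `m'`
  have hm'sq : Squarefree m' := hsupp.1.squarefree_of_dvd (dvd_mul_left m' ℓ)
  refine ctLevelPairing_pullback_ne_zero_iff_localTerm_kolyvagin e hμ hadd₁ hadd₂ hgal inv halt hPT'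
    hH3 hfin ι hι _ _ (cl (ℓ * m')) ((p : ℤ) ^ (j - M₀)) hz' hℓ.1.place
    {v | ∃ q ∈ m'.primeFactors, (q : 𝓞 K) ∈ v.asIdeal} ?_ ?_ ?_ D hD₁ hDt
  · -- `c(n)` is Selmer off `λ` and the places of `m'` (Lemma 4.3; the complex place)
    intro v hv0 hvT
    rcases v with w | v
    · haveI : IsAlgClosed w.Completion :=
        isAlgClosed_of_ringEquiv (InfinitePlace.Completion.ringEquivComplexOfIsComplex
          (hK.2.isComplex w)).symm
      rw [selmerLocalKer_completion_inl, WeierstrassCurve.selmerLocalKer_eq_top_of_isAlgClosed]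
      trivial
    · rw [selmerLocalKer_completion_inr]
      refine hcl (ℓ * m') hsupp.1 hsupp.2 v ?_
      intro hmem
      obtain h | h := natCast_mul_mem_asIdeal hmem
      · exact hv0 (by rw [hℓ.1.mem_iff.mp h])
      · obtain ⟨q, hq, hqv⟩ := exists_mem_primeFactors_natCast_mem' hm'sq h
        exact hvT v ⟨q, hq, hqv⟩ rfl
  · -- `t_v = 0` at the places over the primes of `m'`
    rintro v ⟨q, hq, hqv⟩
    haveI : CharZero (v.adicCompletion K) :=
      charZero_of_injective_algebraMap (algebraMap K (v.adicCompletion K)).injective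
    exact (mem_torsionLocalKer_iff_res_eq_zero (W.baseChange K) (v.adicCompletion K) hk0 t).mp
      (hAq q hq v hqv)
  · -- `Γ_{K_v}` fixes `E[p^{2M₀}]` at the (Kolyvagin) places of `m'`
    rintro v ⟨q, hq, hqv⟩ g Q
    have hqn : q ∈ (ℓ * m').primeFactors :=
      Nat.primeFactors_mono (dvd_mul_left m' ℓ) hsupp.1.ne_zero hq
    have hKol := hsupp.2 q hqn
    have hv : v = hKol.1.place := hKol.1.mem_iff.mp hqv
    subst hv
    haveI : NeZero (p ^ M₀ * p ^ M₀) := ⟨hk0⟩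
    have hpv : ((p : ℕ) : 𝓞 K) ∉ hKol.1.place.asIdeal :=
      not_natCast_mem_of_prime_ne hKol.1.prime hp hKol.1.2.2.2.1 hKol.1.place hKol.1.mem_place
    have hqlam : ((((p ^ M₀ * p ^ M₀ : ℕ) : ℤ)) : 𝓞 K) ∉ hKol.1.place.asIdeal := by
      have h3 : ((((p ^ M₀ * p ^ M₀ : ℕ) : ℤ)) : 𝓞 K) = ((p : ℕ) : 𝓞 K) ^ (M₀ + M₀) := by
        push_cast
        ring
      rw [h3]
      exact fun h => hpv (hKol.1.place.isPrime.mem_of_pow_mem _ h)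
    exact absGaloisRestrict_smul_geomTorsion_eq_of_kolyvaginPrime W hK hKol.1 hKol.2
      (hbad hKol.1) hqlam g Q

end Value

namespace HypothesesM

variable [W.IsElliptic] {p M₀ : ℕ} [NeZero (p ^ M₀)]
variable (e : geomTorsion (W.baseChange K) ((p ^ M₀ * p ^ M₀ : ℕ) : ℤ) →
    geomTorsion (W.baseChange K) ((p ^ M₀ * p ^ M₀ : ℕ) : ℤ) → AlgebraicClosure K)
  (hμ : ∀ S T, e S T ^ (p ^ M₀ * p ^ M₀) = 1)
  (hadd₁ : ∀ S₁ S₂ T, e (S₁ + S₂) T = e S₁ T * e S₂ T)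
  (hadd₂ : ∀ S T₁ T₂, e S (T₁ + T₂) = e S T₁ * e S T₂)
  (hgal : ∀ (σ : absoluteGaloisGroup K) (S T : geomTorsion (W.baseChange K) ((p ^ M₀ * p ^ M₀ : ℕ) : ℤ)),
    σ • e S T = e (σ • S) (σ • T))
variable (inv : LocalInvariants K (p ^ M₀ * p ^ M₀))
-- `hPT'` is the reciprocity predicate `LocalInvariants.SumInvLocalizationEqZero` on `inv`, not a named fact.
variable (halt : ∀ T, e T T = 1) (hPT' : inv.SumInvLocalizationEqZero)
  (hH3 : ∀ c : galoisCohomology (mu K (p ^ M₀ * p ^ M₀)) 3,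
    (∀ v : Place K, galoisCohomology.localization (mu K (p ^ M₀ * p ^ M₀)) v 3 c = 0) → c = 0)
  (hfin : ∀ D : GeneralCaseData (W.baseChange K) (p ^ M₀) e hμ hadd₁ hadd₂ hgal,
    ∃ S : Finset (Place K), ∀ v ∉ S, D.localTerm inv v = 0)
variable (ι : selmerGroup (W.baseChange K) ((p ^ M₀ * p ^ M₀ : ℕ) : ℤ) →+ ((W.baseChange K).sha)[p ^ M₀])
  (hι : ∀ z, shaTorsionVal (W.baseChange K) (p ^ M₀) (ι z) =
    torsionH1ToH1 (W.baseChange K) ((p ^ M₀ * p ^ M₀ : ℕ) : ℤ) z)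

include halt hPT' hι in
/-- **`hCTV` from the local term at `λ`, for an abstract family of classes.** Verbatim the tree's
`HypothesesM.hCTV_of_localTerm` (`HeegnerPointsKolyvaginPrimaryOrderHCTVProofs`) with the Heegner-point
binder `IsHeegnerPoint N₀ W K Pt` replaced by its only use, good reduction of `E/K` at the
Kolyvagin primes of level `N₀` (`hbad`). Let `S` be descent data on `H¹(K, E[p^{2M₀}])` with the
dictionary of `exists_hypothesesM_of_leavesM_dictionary_level`, the classes `c(·)` Selmer off `n`
(McCallum's Lemma 4.3), and `P = B(ι ·, ι ·)` on `S.Sel` the pulled-back level-`p^{M₀}` Cassels–Tate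
pairing. If McCallum's Lemma 5.3 holds at `λ` for the first-case data of every Kolyvagin pair of the
telescope (`hloc`), then the value formula `hCTV` of `card_quotient_le_of_casselsTate` holds for `P`.
[cite: McCallumLMS1991, §4 Prop. 4.7, §5 Lemma 5.3, Thm. 5.4 (proof)] [cite: MilneADT2006, Ch. I §6, Prop. 6.9] -/
theorem hCTV_of_localTerm_of_notMemBad
    (hK : IsImaginaryQuadratic K) {N₀ : ℕ} [NeZero N₀]
    (hbad : ∀ ⦃q : ℕ⦄ (h : IsKolyvaginPrime N₀ W K p q), h.place ∉ (W.baseChange K).badPlaces (𝓞 K))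
    (hp : p.Prime) (hp2 : p ≠ 2) (hρ : W.HasSurjectiveModNGaloisRep p)
    (c : K ≃ₐ[ℚ] K) (ε : ℤ) (cl : ℕ → galH1Torsion (W.baseChange K) ((p ^ M₀ * p ^ M₀ : ℕ) : ℤ))
    (hcl : ∀ n : ℕ, Squarefree n →
      (∀ q ∈ n.primeFactors, IsKolyvaginPrime N₀ W K p q ∧ FrobEqFrobInfty W K (p ^ M₀ * p ^ M₀) q) →
      ∀ v : HeightOneSpectrum (𝓞 K), (n : 𝓞 K) ∉ v.asIdeal →
        cl n ∈ selmerLocalKer (W.baseChange K) (v.adicCompletion K) ((p ^ M₀ * p ^ M₀ : ℕ) : ℤ))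
    (S : HypothesesM (galH1Torsion (W.baseChange K) ((p ^ M₀ * p ^ M₀ : ℕ) : ℤ))
      (HeightOneSpectrum (𝓞 K) ⊕ InfinitePlace K))
    (hSel : S.Sel = selmerGroup (W.baseChange K) ((p ^ M₀ * p ^ M₀ : ℕ) : ℤ)) (hSp : S.p = p)
    (hSM₀ : S.M₀ = M₀) (hSM : S.M = 2 * M₀)
    (hSτ : ∀ g, S.τ g = conjAct W c ((p ^ M₀ * p ^ M₀ : ℕ) : ℤ) g)
    (hSKol : ∀ ℓ, S.Kol ℓ ↔ IsKolyvaginPrime N₀ W K p ℓ ∧ FrobEqFrobInfty W K (p ^ M₀ * p ^ M₀) ℓ)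
    (hSA : ∀ ℓ g, g ∈ S.A ℓ ↔ ∀ v : HeightOneSpectrum (𝓞 K), (ℓ : 𝓞 K) ∈ v.asIdeal →
      g ∈ (W.baseChange K).torsionLocalKer (v.adicCompletion K) ((p ^ M₀ * p ^ M₀ : ℕ) : ℤ))
    (hSc : ∀ n, S.c n = cl n) (hSε : S.ε = ε)
    (hloc : ∀ ℓ m : ℕ,
      (hℓ : IsKolyvaginPrime N₀ W K p ℓ ∧ FrobEqFrobInfty W K (p ^ M₀ * p ^ M₀) ℓ) →
      KolSupp (fun q => IsKolyvaginPrime N₀ W K p q ∧ FrobEqFrobInfty W K (p ^ M₀ * p ^ M₀) q) (ℓ * m) →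
      ¬ ℓ ∣ m →
      ∀ (j N a b : ℕ) (t : galH1Torsion (W.baseChange K) ((p ^ M₀ * p ^ M₀ : ℕ) : ℤ)),
      t ∈ selmerGroup (W.baseChange K) ((p ^ M₀ * p ^ M₀ : ℕ) : ℤ) →
      ((p : ℤ) ^ j) • cl (ℓ * m) ∈ selmerGroup (W.baseChange K) ((p ^ M₀ * p ^ M₀ : ℕ) : ℤ) →
      ((p : ℤ) ^ N) • t = 0 →
      conjAct W c ((p ^ M₀ * p ^ M₀ : ℕ) : ℤ) t = (ε * (-1) ^ (ℓ * m).primeFactors.card) • t →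
      (∀ q ∈ m.primeFactors, ∀ v : HeightOneSpectrum (𝓞 K), (q : 𝓞 K) ∈ v.asIdeal →
        t ∈ (W.baseChange K).torsionLocalKer (v.adicCompletion K) ((p ^ M₀ * p ^ M₀ : ℕ) : ℤ)) →
      M₀ ≤ j → N ≤ M₀ → N ≤ j → a + b + 1 = N →
      (¬ ∀ v : HeightOneSpectrum (𝓞 K), (ℓ : 𝓞 K) ∈ v.asIdeal →
        ((p : ℤ) ^ (a + (j - N))) • cl m ∈
          (W.baseChange K).torsionLocalKer (v.adicCompletion K) ((p ^ M₀ * p ^ M₀ : ℕ) : ℤ)) →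
      (¬ ∀ v : HeightOneSpectrum (𝓞 K), (ℓ : 𝓞 K) ∈ v.asIdeal →
        ((p : ℤ) ^ b) • t ∈ (W.baseChange K).torsionLocalKer (v.adicCompletion K) ((p ^ M₀ * p ^ M₀ : ℕ) : ℤ)) →
      ∀ D : FirstCaseData (W.baseChange K) (p ^ M₀), D.b₁ = ((p : ℤ) ^ (j - M₀)) • cl (ℓ * m) →
        galoisCohomology.map (inclKD (W.baseChange K) (p ^ M₀) (p ^ M₀)) 1 D.b' = t →
        D.localTerm e hμ hadd₁ hadd₂ hgal inv (Sum.inr hℓ.1.place) ≠ 0) :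
    ∀ ℓ m : ℕ, S.Kol ℓ → KolSupp S.Kol (ℓ * m) → ¬ ℓ ∣ m →
      ∀ (j N a b : ℕ) (t : galH1Torsion (W.baseChange K) ((p ^ M₀ * p ^ M₀ : ℕ) : ℤ))
        (ht : t ∈ S.Sel) (hz : ((S.p : ℤ) ^ j) • S.c (ℓ * m) ∈ S.Sel),
      ((S.p : ℤ) ^ N) • t = 0 → S.τ t = (S.ε * (-1) ^ (ℓ * m).primeFactors.card) • t →
      (∀ q ∈ m.primeFactors, t ∈ S.A q) → S.M - S.M₀ ≤ j → N + S.M₀ ≤ S.M → N ≤ j → a + b + 1 = N →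
      ((S.p : ℤ) ^ (a + (j - N))) • S.c m ∉ S.A ℓ → ((S.p : ℤ) ^ b) • t ∉ S.A ℓ →
      (((ctLevelPairing (W.baseChange K) (p ^ M₀) e hμ hadd₁ hadd₂ hgal inv halt hPT' hH3 hfin).comp
          (ι.comp (AddSubgroup.inclusion hSel.le))).compl₂ (ι.comp (AddSubgroup.inclusion hSel.le)))
        ⟨_, hz⟩ ⟨t, ht⟩ ≠ 0 := by
  intro ℓ m hKolℓ hsupp hℓm j N a b t ht hz hpt hτt hAq hMj hNM hNj hab hordc hordt
  -- translate through the dictionary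
  have hℓ : IsKolyvaginPrime N₀ W K p ℓ ∧ FrobEqFrobInfty W K (p ^ M₀ * p ^ M₀) ℓ := (hSKol ℓ).mp hKolℓ
  have hsupp' : KolSupp (fun q => IsKolyvaginPrime N₀ W K p q ∧ FrobEqFrobInfty W K (p ^ M₀ * p ^ M₀) q)
      (ℓ * m) := ⟨hsupp.1, fun q hq => (hSKol q).mp (hsupp.2 q hq)⟩
  have ht' : t ∈ selmerGroup (W.baseChange K) ((p ^ M₀ * p ^ M₀ : ℕ) : ℤ) := hSel ▸ ht
  have hz' : ((p : ℤ) ^ j) • cl (ℓ * m) ∈ selmerGroup (W.baseChange K) ((p ^ M₀ * p ^ M₀ : ℕ) : ℤ) := by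
    have h := hz
    rw [hSp, hSc, hSel] at h
    exact h
  have hpt' : ((p : ℤ) ^ N) • t = 0 := by
    have h := hpt
    rw [hSp] at h
    exact h
  have hτt' : conjAct W c ((p ^ M₀ * p ^ M₀ : ℕ) : ℤ) t = (ε * (-1) ^ (ℓ * m).primeFactors.card) • t := by
    rw [← hSτ, ← hSε]; exact hτt
  have hAq' : ∀ q ∈ m.primeFactors, ∀ v : HeightOneSpectrum (𝓞 K), (q : 𝓞 K) ∈ v.asIdeal →
      t ∈ (W.baseChange K).torsionLocalKer (v.adicCompletion K) ((p ^ M₀ * p ^ M₀ : ℕ) : ℤ) :=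
    fun q hq => (hSA q t).mp (hAq q hq)
  have hMj' : M₀ ≤ j := by rw [hSM, hSM₀] at hMj; omega
  have hNM' : N ≤ M₀ := by rw [hSM, hSM₀] at hNM; omega
  have hordc' : ¬ ∀ v : HeightOneSpectrum (𝓞 K), (ℓ : 𝓞 K) ∈ v.asIdeal →
      ((p : ℤ) ^ (a + (j - N))) • cl m ∈
        (W.baseChange K).torsionLocalKer (v.adicCompletion K) ((p ^ M₀ * p ^ M₀ : ℕ) : ℤ) := by
    intro h
    apply hordc
    rw [hSp, hSc]
    exact (hSA ℓ _).mpr h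
  have hordt' : ¬ ∀ v : HeightOneSpectrum (𝓞 K), (ℓ : 𝓞 K) ∈ v.asIdeal →
      ((p : ℤ) ^ b) • t ∈ (W.baseChange K).torsionLocalKer (v.adicCompletion K) ((p ^ M₀ * p ^ M₀ : ℕ) : ℤ) := by
    intro h
    apply hordt
    rw [hSp]
    exact (hSA ℓ _).mpr h
  -- McCallum Prop. 4.7: the value is the local term at `λ`
  obtain ⟨⟨D, hD₁, hDt⟩, hiff⟩ :=
    ctLevelPairing_pullback_ne_zero_iff_localTerm_kolyvaginClass_of_notMemBad W e hμ hadd₁ hadd₂ hgal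
      inv halt hPT' hH3 hfin ι hι hK hbad hp hp2 hρ cl hcl hℓ hsupp' hMj' hNM' ht' hz' hpt' hAq'
  have hne := (hiff D hD₁ hDt).mpr (hloc ℓ m hℓ hsupp' hℓm j N a b t ht' hz' hpt' hτt' hAq' hMj'
    hNM' hNj hab hordc' hordt' D hD₁ hDt)
  -- unfold `P = B(ι ∘ incl ·, ι ∘ incl ·)`
  have e1 : AddSubgroup.inclusion hSel.le ⟨_, hz⟩ = ⟨_, hz'⟩ :=
    Subtype.ext (show ((S.p : ℤ) ^ j) • S.c (ℓ * m) = ((p : ℤ) ^ j) • cl (ℓ * m) by rw [hSp, hSc])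
  have e2 : AddSubgroup.inclusion hSel.le ⟨t, ht⟩ = ⟨t, ht'⟩ := Subtype.ext rfl
  change ctLevelPairing (W.baseChange K) (p ^ M₀) e hμ hadd₁ hadd₂ hgal inv halt hPT' hH3 hfin
      (ι (AddSubgroup.inclusion hSel.le ⟨_, hz⟩)) (ι (AddSubgroup.inclusion hSel.le ⟨t, ht⟩)) ≠ 0
  rw [e1, e2]
  exact hne

end HypothesesM

end KolyvaginDescent

end Literature.NumberTheory.EllipticCurves

end
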